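import Summits.CriticalPhenomena.PercolationContinuityZ3.Theorems.Transplant.PlanarSkeletonFrmFromDefs
import Summits.CriticalPhenomena.PercolationContinuityZ3.Theorems.Transplant.SkelFrmFromBChoiceRootLanding
import Summits.CriticalPhenomena.PercolationContinuityZ3.Theorems.Transplant.SkelFrmBChoiceRootLanding
import HarnessLib
import Summits.CriticalPhenomena.PercolationContinuityZ3.Theorems.Transplant.SkelFrmBChoiceRootLanding2
/-!
# U-WAVE PORT (RULING D-U, lead g21 2026-08-26; WAVE-U-MANIFEST v3.0 row «SkelFrmBChoiceRootLanding2» ↦ «SkelFrmFromBChoiceRootLanding2») of the tree module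
# `Transplant/SkelFrmBChoiceRootLanding2` onto the carrier `PlanarSkeletonFrmFrom` (frames only, cylinders connected from width `ℓ₀` on)

ORIGINAL TITLE: N2 (frames-only node `SamePDropOfSkeletonFrm₁`, OPEN), (R) column FIRST axis — **(R-47)(a): THE BRIDGE LANDING ON THE TERMINAL'S SHEAR LINE**

builds on p205010 (kernel theorem, internal audit signed; external expert review pending) — nothing in this file uses p205010; NOTHING is claimed about the
OPEN node U `SamePDropOfSkeletonFrmFrom₁` (nor U_s / the end state).  Lane `prim-bschramm`, seat `prim-hp-8 gen 53 (U-wave port pen, family P-hp8; tool of record = p3-g26 port_u.py)`; helper file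
(`--supports stmt-CriticalPhenomena-4575 --as helper`).  PORT RULES r1–r4 of RULING D-U: declaration order and proof texts are those of the original,
byte-identical except (i) the carrier token `PlanarSkeletonFrm ↦ PlanarSkeletonFrmFrom` (binders, `namespace`/`end` lines, qualified names of twinned
declarations), (ii) carrier-FREE declarations of the original (φ-level `Skelφ…` blocks and namespace-only arithmetic residents) are NOT re-declared —
this file imports the original and `export`s the twin-free residents (POLICY T / treatment (m1)); residents whose statement mentions a twinned
constant are copied, (iii) every carrier-binding declaration keeps its explicit binder `(Φ : PlanarSkeletonFrmFrom G)` in its own signature (r2).  Docstrings and citations are the original's.  Manifest row idx 127 (level 16; flags verbatim|DEF-ROW); filed by the hp-8 lineage under RULING M-11 (family P-hp8).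
-/

noncomputable section

open scoped Classical

namespace Summit.CriticalPhenomena.PercolationContinuityZ3.Theorems.Transplant

namespace PlanarSkeletonFrmFrom

namespace NegB

open Literature.Probability.Percolation Literature.Probability.LatticeModels SimpleGraph
open Literature.Barriers.CriticalPhenomena (graphBall)
open SkelConc (Consts)
open Skelφ (rootFrame shearUnit)
open ChainPlanar (BridgePrm BridgeOK)
open Neg

namespace KS

section Landing2

variable (κ : Consts) {V : Type} [DecidableEq V] [Countable V] {G : SimpleGraph V} [G.LocallyFinite] (Φ : PlanarSkeletonFrmFrom G) (t : V) (p : unitInterval)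
  (D : Skelφ.StepI.DataNS V) (mk g f qq : ℕ)

/-- **The landing height on the terminal's shear line** `Y1s := ⌈h_L·X1/n_L⌉`. [this work] -/
def Y1s (κ : Consts) {V : Type} [DecidableEq V] [Countable V] {G : SimpleGraph V} [G.LocallyFinite] (Φ : PlanarSkeletonFrmFrom G) (t : V) (p : unitInterval) (D : Skelφ.StepI.DataNS V) (mk : ℕ) (g : ℕ) (f : ℕ) (qq : ℕ) : ℤ := -((-((hL κ Φ t p D g f) * (X1 κ Φ t p D mk g f qq))) / (nL κ Φ t p D g f : ℤ))

/-- **The landing depth** `D0s := |X1| + |Y1s|`. [this work] -/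
def D0s (κ : Consts) {V : Type} [DecidableEq V] [Countable V] {G : SimpleGraph V} [G.LocallyFinite] (Φ : PlanarSkeletonFrmFrom G) (t : V) (p : unitInterval) (D : Skelφ.StepI.DataNS V) (mk : ℕ) (g : ℕ) (f : ℕ) (qq : ℕ) : ℕ := ((X1 κ Φ t p D mk g f qq)).natAbs + ((Y1s κ Φ t p D mk g f qq)).natAbs

/-- **The landing sits on the shear line through `t`**: `0 ≤ n_L·Y1s − h_L·X1 < n_L` and `⌊(n_L·Y1s − h_L·X1)/U⌋ = 0`. [folklore] -/
theorem rows_c₁s_zero (κ : Consts) {V : Type} [DecidableEq V] [Countable V] {G : SimpleGraph V} [G.LocallyFinite] (Φ : PlanarSkeletonFrmFrom G) (t : V) (p : unitInterval) (D : Skelφ.StepI.DataNS V) (mk : ℕ) (g : ℕ) (f : ℕ) (qq : ℕ) (hN : EqNumL κ Φ t p D g f) :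
    0 ≤ (nL κ Φ t p D g f : ℤ) * (Y1s κ Φ t p D mk g f qq) - (hL κ Φ t p D g f) * (X1 κ Φ t p D mk g f qq) ∧ (nL κ Φ t p D g f : ℤ) * (Y1s κ Φ t p D mk g f qq) - (hL κ Φ t p D g f) * (X1 κ Φ t p D mk g f qq) < (nL κ Φ t p D g f : ℤ) ∧
      ((nL κ Φ t p D g f : ℤ) * (Y1s κ Φ t p D mk g f qq) - (hL κ Φ t p D g f) * (X1 κ Φ t p D mk g f qq)) / (shearUnit (nL κ Φ t p D g f) (hL κ Φ t p D g f) : ℤ) = 0 := by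
  have hn1 : (1 : ℤ) ≤ (nL κ Φ t p D g f : ℤ) := by exact_mod_cast (one_le_of_eqNumL κ Φ t p D g f hN).1
  have hn0 : (0 : ℤ) < (nL κ Φ t p D g f : ℤ) := by linarith
  have hY : (Y1s κ Φ t p D mk g f qq) = -((-((hL κ Φ t p D g f) * (X1 κ Φ t p D mk g f qq))) / (nL κ Φ t p D g f : ℤ)) := rfl
  have h1 := Int.ediv_mul_le (-((hL κ Φ t p D g f) * (X1 κ Φ t p D mk g f qq))) (ne_of_gt hn0)
  have h2 := Int.lt_ediv_add_one_mul_self (-((hL κ Φ t p D g f) * (X1 κ Φ t p D mk g f qq))) hn0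
  have hlo : 0 ≤ (nL κ Φ t p D g f : ℤ) * (Y1s κ Φ t p D mk g f qq) - (hL κ Φ t p D g f) * (X1 κ Φ t p D mk g f qq) := by rw [hY]; nlinarith
  have hhi : (nL κ Φ t p D g f : ℤ) * (Y1s κ Φ t p D mk g f qq) - (hL κ Φ t p D g f) * (X1 κ Φ t p D mk g f qq) < (nL κ Φ t p D g f : ℤ) := by rw [hY]; nlinarith
  refine ⟨hlo, hhi, ?_⟩
  have hU : (nL κ Φ t p D g f : ℤ) ≤ (shearUnit (nL κ Φ t p D g f) (hL κ Φ t p D g f) : ℤ) := by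
    unfold Skelφ.shearUnit; push_cast
    have := abs_nonneg (hL κ Φ t p D g f)
    have : (((hL κ Φ t p D g f)).natAbs : ℤ) = |(hL κ Φ t p D g f)| := Int.natCast_natAbs _
    linarith
  exact Int.ediv_eq_zero_of_lt hlo (lt_of_lt_of_le hhi hU)

/-- **THE LANDING VERTEX EXISTS** (any planar map with unit steps): `c₁* ∈ B_G(t, D0s)` with `ψ c₁* − ψ t = (X1, Y1s)`. [folklore] -/
theorem exists_landing0s (κ : Consts) {V : Type} [DecidableEq V] [Countable V] {G : SimpleGraph V} [G.LocallyFinite] (Φ : PlanarSkeletonFrmFrom G) (t : V) (p : unitInterval) (D : Skelφ.StepI.DataNS V) (mk : ℕ) (g : ℕ) (f : ℕ) (qq : ℕ) {ψ : V → Site 2} (hstep : Skelφ.Steps G ψ) :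
    ∃ c₁, c₁ ∈ graphBall G t (D0s κ Φ t p D mk g f qq) ∧ ψ c₁ 0 - ψ t 0 = (X1 κ Φ t p D mk g f qq) ∧ ψ c₁ 1 - ψ t 1 = (Y1s κ Φ t p D mk g f qq) := by
  obtain ⟨c₁, hc, hy⟩ := Skelφ.exists_mem_graphBall_φ_eq hstep t (ψ t + Skelφ.pt (X1 κ Φ t p D mk g f qq) (Y1s κ Φ t p D mk g f qq))
  have e0 : (ψ t + Skelφ.pt (X1 κ Φ t p D mk g f qq) (Y1s κ Φ t p D mk g f qq)) 0 - ψ t 0 = (X1 κ Φ t p D mk g f qq) := by simp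
  have e1 : (ψ t + Skelφ.pt (X1 κ Φ t p D mk g f qq) (Y1s κ Φ t p D mk g f qq)) 1 - ψ t 1 = (Y1s κ Φ t p D mk g f qq) := by simp
  rw [e0, e1] at hc
  refine ⟨c₁, hc, ?_, ?_⟩
  · have := congrFun hy 0; simp only [Pi.add_apply, Skelφ.pt_zero] at this; linarith
  · have := congrFun hy 1; simp only [Pi.add_apply, Skelφ.pt_one] at this; linarith

/-- **THE SIX ROWS OF THE CROSS LINK AT THE NEW LANDING** `(X1, Y1s)`: along exact as before (`R′0 ≤ q`); across, the bridge's core-1 box sits within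
`(prB0 + R′0 + 1)·U + n_L(ℓ_L + 2R′0 + ℓB0) + 2|h_L|R′0` of the origin's shear line (`|hB0|, nB0 ≤ prB0`, `n_L·h_L = h_L·n_L`), absorbed by
`(P + W)·U ≥ n_Lℓ_L + 1 + W·U` once `prB0 + ℓB0 + 5R′0 + 2 ≤ W`. [cite: KozmaNitzan2024, §4 Lemma 11 (p. 22)] -/
theorem hx_rows_0s (κ : Consts) {V : Type} [DecidableEq V] [Countable V] {G : SimpleGraph V} [G.LocallyFinite] (Φ : PlanarSkeletonFrmFrom G) (t : V) (p : unitInterval) (D : Skelφ.StepI.DataNS V) (mk : ℕ) (g : ℕ) (f : ℕ) (qq : ℕ) {W : ℕ} (hN : EqNumL κ Φ t p D g f) (hW : ((prB0 κ Φ t p D mk) : ℤ) + (ℓB0 κ Φ t p D mk) + 5 * (KS0.R'0 κ Φ t p D mk : ℤ) + 2 ≤ W) (hRq : KS0.R'0 κ Φ t p D mk ≤ qq) :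
    (X1 κ Φ t p D mk g f qq) - qq ≤ (B0 κ Φ t p D mk g f).core1Lo 0 ∧ (B0 κ Φ t p D mk g f).core1Hi 0 ≤ (X1 κ Φ t p D mk g f qq) + qq ∧
    -((((nL κ Φ t p D g f) * (ℓL κ Φ t p D g f) / shearUnit (nL κ Φ t p D g f) (hL κ Φ t p D g f) + 1 + W : ℕ) : ℤ) * (shearUnit (nL κ Φ t p D g f) (hL κ Φ t p D g f) : ℤ)) ≤ (nL κ Φ t p D g f : ℤ) * ((B0 κ Φ t p D mk g f).core1Lo 1 - (Y1s κ Φ t p D mk g f qq)) - (hL κ Φ t p D g f) * ((B0 κ Φ t p D mk g f).core1Lo 0 - (X1 κ Φ t p D mk g f qq)) ∧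
    -((((nL κ Φ t p D g f) * (ℓL κ Φ t p D g f) / shearUnit (nL κ Φ t p D g f) (hL κ Φ t p D g f) + 1 + W : ℕ) : ℤ) * (shearUnit (nL κ Φ t p D g f) (hL κ Φ t p D g f) : ℤ)) ≤ (nL κ Φ t p D g f : ℤ) * ((B0 κ Φ t p D mk g f).core1Lo 1 - (Y1s κ Φ t p D mk g f qq)) - (hL κ Φ t p D g f) * ((B0 κ Φ t p D mk g f).core1Hi 0 - (X1 κ Φ t p D mk g f qq)) ∧
    (nL κ Φ t p D g f : ℤ) * ((B0 κ Φ t p D mk g f).core1Hi 1 - (Y1s κ Φ t p D mk g f qq)) - (hL κ Φ t p D g f) * ((B0 κ Φ t p D mk g f).core1Lo 0 - (X1 κ Φ t p D mk g f qq)) ≤ (((nL κ Φ t p D g f) * (ℓL κ Φ t p D g f) / shearUnit (nL κ Φ t p D g f) (hL κ Φ t p D g f) + 1 + W : ℕ) : ℤ) * (shearUnit (nL κ Φ t p D g f) (hL κ Φ t p D g f) : ℤ) ∧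
    (nL κ Φ t p D g f : ℤ) * ((B0 κ Φ t p D mk g f).core1Hi 1 - (Y1s κ Φ t p D mk g f qq)) - (hL κ Φ t p D g f) * ((B0 κ Φ t p D mk g f).core1Hi 0 - (X1 κ Φ t p D mk g f qq)) ≤ (((nL κ Φ t p D g f) * (ℓL κ Φ t p D g f) / shearUnit (nL κ Φ t p D g f) (hL κ Φ t p D g f) + 1 + W : ℕ) : ℤ) * (shearUnit (nL κ Φ t p D g f) (hL κ Φ t p D g f) : ℤ) := by
  have hn := (one_le_of_eqNumL κ Φ t p D g f hN).1
  obtain ⟨c0, c1, c2, c3⟩ := B0_core1 κ Φ t p D mk g f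
  obtain ⟨hr0, hrn, -⟩ := rows_c₁s_zero κ Φ t p D mk g f qq hN
  have hn0 : (0 : ℤ) < (nL κ Φ t p D g f : ℤ) := by exact_mod_cast hn
  have hR0 : (0 : ℤ) ≤ (KS0.R'0 κ Φ t p D mk : ℤ) := by positivity
  have hRq' : (((KS0.R'0 κ Φ t p D mk) : ℕ) : ℤ) ≤ (qq : ℤ) := by exact_mod_cast hRq
  have hW0 : (0 : ℤ) ≤ (W : ℤ) := by positivity
  have hℓ0 : (0 : ℤ) ≤ ((ℓL κ Φ t p D g f) : ℤ) := by positivity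
  have hℓB0 : (0 : ℤ) ≤ ((ℓB0 κ Φ t p D mk) : ℤ) := by positivity
  -- |hB0| ≤ prB0, nB0 ≤ prB0
  have hpr := le_prB0 κ Φ t p D mk
  have hnB : (((nB0 κ Φ t p D mk) : ℕ) : ℤ) ≤ (prB0 κ Φ t p D mk) := by exact_mod_cast hpr.1
  have hhB : |(hB0 κ Φ t p D mk)| ≤ ((prB0 κ Φ t p D mk) : ℤ) := by
    have h2 : ((3 * (ℓB0 κ Φ t p D mk) + ((hB0 κ Φ t p D mk)).natAbs : ℕ) : ℤ) ≤ (prB0 κ Φ t p D mk) := by exact_mod_cast hpr.2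
    push_cast [Int.natCast_natAbs] at h2; linarith
  obtain ⟨hhB1, hhB2⟩ := abs_le.1 hhB
  have hnB0 : (0 : ℤ) ≤ (((nB0 κ Φ t p D mk) : ℕ) : ℤ) := by positivity
  -- the shear unit and the budget
  have hU : (shearUnit (nL κ Φ t p D g f) (hL κ Φ t p D g f) : ℤ) = (nL κ Φ t p D g f : ℤ) + |(hL κ Φ t p D g f)| := by
    unfold Skelφ.shearUnit; push_cast [Int.natCast_natAbs]; rfl
  have hB := budget_mul_shearUnit_ge (nL κ Φ t p D g f) (ℓL κ Φ t p D g f) W (hL κ Φ t p D g f) hn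
  rw [hU] at hB ⊢
  have habs : (0 : ℤ) ≤ |(hL κ Φ t p D g f)| := abs_nonneg _
  obtain ⟨hh1, hh2⟩ := abs_le.1 (le_refl |(hL κ Φ t p D g f)|)
  -- products against |h_L| and n_L
  have p1 : |(hL κ Φ t p D g f) * (((nB0 κ Φ t p D mk) : ℕ) : ℤ)| ≤ |(hL κ Φ t p D g f)| * (prB0 κ Φ t p D mk) := by rw [abs_mul, abs_of_nonneg hnB0]; exact mul_le_mul_of_nonneg_left hnB habs
  obtain ⟨p1a, p1b⟩ := abs_le.1 p1
  have p2 : |(hL κ Φ t p D g f) * (KS0.R'0 κ Φ t p D mk : ℤ)| = |(hL κ Φ t p D g f)| * (KS0.R'0 κ Φ t p D mk : ℤ) := by rw [abs_mul, abs_of_nonneg hR0]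
  obtain ⟨p2a, p2b⟩ := abs_le.1 (le_of_eq p2)
  have p3 : |(nL κ Φ t p D g f : ℤ) * (hB0 κ Φ t p D mk)| ≤ (nL κ Φ t p D g f : ℤ) * (prB0 κ Φ t p D mk) := by rw [abs_mul, abs_of_nonneg hn0.le]; exact mul_le_mul_of_nonneg_left hhB hn0.le
  obtain ⟨p3a, p3b⟩ := abs_le.1 p3
  have hWU : (((prB0 κ Φ t p D mk) : ℤ) + (ℓB0 κ Φ t p D mk) + 5 * (KS0.R'0 κ Φ t p D mk : ℤ) + 2) * ((nL κ Φ t p D g f : ℤ) + |(hL κ Φ t p D g f)|) ≤ (W : ℤ) * ((nL κ Φ t p D g f : ℤ) + |(hL κ Φ t p D g f)|) :=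
    mul_le_mul_of_nonneg_right hW (by positivity)
  have e1 : (W : ℤ) * (nL κ Φ t p D g f : ℤ) + (W : ℤ) * |(hL κ Φ t p D g f)| = (W : ℤ) * ((nL κ Φ t p D g f : ℤ) + |(hL κ Φ t p D g f)|) := by ring
  have hpr0 : (0 : ℤ) ≤ ((prB0 κ Φ t p D mk) : ℤ) := by positivity
  have q1 : (0 : ℤ) ≤ (nL κ Φ t p D g f : ℤ) * ((ℓB0 κ Φ t p D mk) : ℤ) := by positivity
  have q2 : (0 : ℤ) ≤ (nL κ Φ t p D g f : ℤ) * (KS0.R'0 κ Φ t p D mk : ℤ) := by positivity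
  have q3 : (0 : ℤ) ≤ |(hL κ Φ t p D g f)| * (KS0.R'0 κ Φ t p D mk : ℤ) := by positivity
  have q4 : (0 : ℤ) ≤ |(hL κ Φ t p D g f)| * ((prB0 κ Φ t p D mk) : ℤ) := by positivity
  have q5 : (0 : ℤ) ≤ (nL κ Φ t p D g f : ℤ) * ((prB0 κ Φ t p D mk) : ℤ) := by positivity
  have q6 : (0 : ℤ) ≤ |(hL κ Φ t p D g f)| * ((ℓB0 κ Φ t p D mk) : ℤ) := by positivity
  have q7 : (0 : ℤ) ≤ (nL κ Φ t p D g f : ℤ) * ((ℓL κ Φ t p D g f) : ℤ) := by positivity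
  -- the sheared coordinate of the origin: n·Y1s = h·X1 + r with r ∈ [0, n)
  rw [c0, c1, c2, c3]
  refine ⟨?_, ?_, ?_, ?_, ?_, ?_⟩
  · rw [X1_eq]; linarith
  · rw [X1_eq]; linarith
  · linarith
  · linarith
  · linarith
  · linarith

/-- **`hx` FOR THE ROOT LEG AT THE NEW LANDING**: at `c₁*` over `(X1, Y1s)`, every root-frame point of the bridge's core-`1` box lies in core `0` of the
corridor `kgCorrSched …` read through `runX ψ c₁* n_L h_L 1`, for every row set `HK` at `R′ := R'0` with `prB0 + ℓB0 + 5R′0 + 2 ≤ W`, `R'0 ≤ q`.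
[cite: KozmaNitzan2024, §4 Lemma 11 (p. 22)] -/
theorem hx_0s (κ : Consts) {V : Type} [DecidableEq V] [Countable V] {G : SimpleGraph V} [G.LocallyFinite] (Φ : PlanarSkeletonFrmFrom G) (t : V) (p : unitInterval) (D : Skelφ.StepI.DataNS V) (mk : ℕ) (g : ℕ) (f : ℕ) (qq : ℕ) {ρ W : ℕ} (hN : EqNumL κ Φ t p D g f)
    (HK : Skelφ.KGRows (nL κ Φ t p D g f) (ℓL κ Φ t p D g f) (hL κ Φ t p D g f) (vL κ Φ t p D g f) (KS0.R'0 κ Φ t p D mk) ρ qq W) (N : ℕ)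
    (hW : ((prB0 κ Φ t p D mk) : ℤ) + (ℓB0 κ Φ t p D mk) + 5 * (KS0.R'0 κ Φ t p D mk : ℤ) + 2 ≤ W) (hRq : KS0.R'0 κ Φ t p D mk ≤ qq)
    {ψ : V → Site 2} {c₁ : V} (hX : ψ c₁ 0 - ψ t 0 = (X1 κ Φ t p D mk g f qq)) (hY : ψ c₁ 1 - ψ t 1 = (Y1s κ Φ t p D mk g f qq))
    {w : V} (hw : rootFrame ψ t 1 w ∈ Finset.Icc (B0 κ Φ t p D mk g f).core1Lo (B0 κ Φ t p D mk g f).core1Hi) :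
    Skelφ.runX ψ c₁ (nL κ Φ t p D g f) (hL κ Φ t p D g f) 1 w ∈ (Skelφ.kgCorrSched (HK.kgVals_ok₁ N) (HK.kgVals_ok₂ N) (HK.kgVals_split N)).core 0 := by
  obtain ⟨hx0, hx1, hs₁, hs₂, hs₃, hs₄⟩ := hx_rows_0s κ Φ t p D mk g f qq hN hW hRq
  exact Skelφ.runX_mem_kgCorrSched_core_zero_of_rootFrame (HK.kgVals_ok₁ N) (HK.kgVals_ok₂ N) (HK.kgVals_split N) HK.hn t c₁ hX hY hx0 hx1 hs₁ hs₂ hs₃ hs₄ hw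

end Landing2

end KS

end NegB

end PlanarSkeletonFrmFrom

end Summit.CriticalPhenomena.PercolationContinuityZ3.Theorems.Transplant

end
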